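import Summits.QuantumFields.YangMills.Theorems.BalabanUVNodesK3V5Defs
import Summits.QuantumFields.YangMills.Theorems.BalabanUVNodesN14ClassLawRoadsBinderAtSpineReadingOfRecord13CoPHV

/-!
# BalabanUVNodes ∕ N14 — K3⁷ v5 STUB 2's REGISTERED TEXT, BY NAME (`K3V5Defs`), AT THE ZERO DIAL ⇐ the KEYED live-selector line + (H-ζ) + ONE KEYED t-free class-law sentence of
# node U3 GIVEN THE RATES; node N14's (I)-binder rides downstream of the same sentence

Cell `pub-ymgap` (HUMAN RULING D-0062 Track A; director-ym №197 ∕ HUMAN RULING D-0149), WIDTH SEAT `pub-ymgap-dag-n14-w2` (g5), CLAIM-1 ∕ INTENT-1 (bus 2026-08-28T05:37Z; in-lane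
successor (t2)′ of this seat's g3 CLAIM-2 located word «at `(jc, sh) = (0, 0)` stub 2's ENTIRE per-tuple body at a live tuple ⇐ ONE t-free sentence of node U3», plan START-LIST v10
§n14 ∕ K3⁷ v5 header l.36).  Filed `--kind proof --supports stmt-QuantumFields-20544 --as helper` (K3⁷ `SpineGivenEndpointR13SepCoPH`; skeleton OF RECORD v5 941dddb108cbaacf, plan g82
l.28563; plan g83 WORDS-1b: v5 STANDS).  COUNT-NEUTRAL.  THEOREMS ONLY (0 `def`).  Imports dag-n27-w1's BY-NAME MIRROR `…K3V5Defs` (p606160 — the v5 predicate TEXTS as tree definitions,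
the `Iff.rfl` bridge and the by-name composition `spineGivenEndpointR13SepCoPH_of_stubTexts`) and this seat's g3 FILE 3 `…N14ClassLawRoadsBinderAtSpineReadingOfRecord13CoPHV` (p603135;
through it FILE 2 p601321 `core_crOfRecord₁₃VAt_zeroDial_of_classSandwich ∕ _of_massSandwich_of_tv`, dag-n20-w1's `…N20ZeroDialFacesAtRecord13CoPHV` shapes
`keyedRelWeight_shape_crOfRecord₁₃V_cutZero ∕ keyedShellWeight_shape_crOfRecord₁₃VAt_cutReading_shellZero ∕ keyedExtraction_shape_crOfRecord₁₃VAt_cutReading_of_live`, dag-n20-d's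
`crOfRecord₁₃V ∕ crOfRecord₁₃VAt` p590105, node00-def-K0c's absolute (H-U) `Node00.localBgMeasurable`) — all BY NAME; edits nothing.

WHY.  Until p606160 the predicates of the registered stub texts (`KeyedRelWeight`, `KeyedShellWeight`, `KeyedExtraction`, `KeyedCoreEdgeHolderD4`, `PinnedAtLive`, `LiveSel`, …) lived
only in the plan's skeleton file, so the N14 ∕ N19 ∕ N20 lanes typed their stub-2 faces PER TUPLE (this seat's g2–g4) or as SPELLED-OUT ∀-shapes (dag-n20-w1 §4).  With the mirror in
the tree the keyed ∀-wrappers can be filed BY NAME against the registered text.  This file does that for node U3's CLASS-LAW road at dag-n20-d's physical-volume spine reading of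
record, at the zero dial `(jc, sh) = (0, 0)`:
* §1 THE FREE DIALS BY NAME — `pinnedAtLive_crOfRecord₁₃VAt_cutReading` (`rfl`), `keyedRelWeight_crOfRecord₁₃V_cutZero` (N20 free at cut 0), `keyedShellWeight_crOfRecord₁₃VAt_cutReading_shellZero`
  (N21 free at the zero split), `keyedExtraction_crOfRecord₁₃VAt_cutReading_of_liveLine` (N27x ⇐ the KEYED live-selector line + (H-ζ); (H-U) is node00-def-K0c's theorem) — dag-n20-w1's
  shapes, now conclusions `K3V5Defs.KeyedRelWeight ∕ KeyedShellWeight ∕ KeyedExtraction ∕ PinnedAtLive`.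
* §2 ★★ `keyedCoreEdgeHolderD4_crOfRecord₁₃VAt_zeroDial_of_keyedClassSandwich` — for EVERY exponent `β`, EVERY rate reading `rr`, EVERY prefix `K₀`: `K3V5Defs.KeyedCoreEdgeHolderD4 β
  (crOfRecord₁₃VAt K₀ 0 0) rr` ⇐ the keyed live line + ONE KEYED sentence under the crux's own prefix «at every guarded admissible tuple, (B) → END → `ForSmallCouplings D` (g₀ ↦ ∀ os,
  GIVEN the R-β rates `PHolderD4 β D (rr …)`: SOME summable `r` and for every `K` ONE constant `c` with `e^{c − r K}•(classMeasA₁₃ K x).map A_{K₀+K} ≤ (classMeasB₁₃ K x).map A_{K₀+K+1} ≤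
  e^{c + r K}•…` AS MEASURES on the unit lattice for EVERY key `x ∈ classSet₁₃ K`)» = NE7-S_cl on the FULL class laws of record GIVEN the rates — node N19′'s located content in class-law
  currency (`ForSmallCouplings.mono` + FILE 2); ★★ `…_of_keyedMassTV` — the MASS_cl ∧ TV_cl twin (dag-n19-c currency).
* §3 ★★★ `stubExpansion13HText_of_liveLine_of_keyedClassSandwich` — the v5 `stub_expansion13H` TEXT VERBATIM in `K3V5Defs` names ⇐ the keyed live line + «stub 2's own two hypotheses
  (`GuardedReadingN16`, `KeyedRatesHolderD4`) ⇒ node U3's keyed sentence at `(β, rrOfRecord 𝔯 ksel)`»; witness `(jc, sh, cr) := (0, 0, crOfRecord₁₃V 0 0)`; ★★ `…_of_keyedMassTV`.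
* §4 ★ `keyedTiltedMeanMatching_crOfRecord₁₃VAt_cutZero_of_keyedClassSandwich` — under the SAME two hypotheses node N14's (I)-binder `TiltedMeanMatching` holds KEYED under the crux's
  prefix at the zero-cut V reading (any shell split), rate `4e^{2l₀}(e^{2|r K|} − 1)` (FILE 3 §2): node N14 = NE1′ adds NO letter to stub 2 — its binder is DOWNSTREAM of U3's sentence.
* §5 `spineGivenEndpointR13SepCoPH_of_stubRatesText_of_liveLine_of_keyedClassSandwich` — K3⁷ BY NAME from stub 1's TEXT (hypothesis `h₁`, verbatim) + the keyed live line + the keyed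
  sentence: ONE application of dag-n27-w1's `K3V5Defs.spineGivenEndpointR13SepCoPH_of_stubTexts` (first refusal offered to dag-n27-c ∕ dag-n27-w1 on the bus).
LOCATED (count-neutral): in K3V5 currency `stub_expansion13H` ⟸ [keyed live-selector line + (H-ζ)] ∧ [node U3's ONE t-free two-run class-law sentence on the full class laws of record,
keyed under the crux's prefix and reading the pinned R-β rates]; the first bracket is the (w18) `… ∧ LiveSel` proviso content as a BINDER, the second is the XL estimate nobody has
produced (dag-n20-w2 LOCATED-2∕3; plan ruling (a)).

HONEST FRAMING.  By-name bookkeeping over HYPOTHESIS SHAPES; ZERO ESTIMATE CONTENT.  The keyed live line `hlive` and the keyed class-law sentence are DISPLAYED hypotheses inhabited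
for NO tuple (K0⁷ `Record13SepCoPHInhabited` OPEN); node U3's two-run sentence is NOT PRINTED for d = 4 and produced by nobody; nothing of Bałaban's is asserted; NE7 ∕ NE7b ∕ NE7c ∕
NE1′ NOT PRINTED for d = 4, NOT proved; N14 ∕ N19 ∕ N20 ∕ N21 ∕ N27 NOT discharged; this is NOT a proof of `stub_expansion13H` (its text is concluded UNDER two displayed keyed
hypotheses) and §5 is NOT a proof of K3⁷ (stub 1's text is a hypothesis too); K3⁷ OPEN, NOT claimed; counts UNMOVED (typed 28∕28 · discharged 5∕28); one finite four-torus programme at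
fixed `ε = L^{−K}`, Bałaban AS PRINTED — the YM mass gap (Clay) is NOT proved by any of this: R4 closes only the conditional finite-𝕋⁴ rung `BalabanLadder.UV`; NOT ℝ⁴, NOT OS, NOT a mass
gap, NOT Clay.  0 `def`, 0 `instance`, 0 `sorry`, standard axioms; no decl below carries a cite tag.
-/

set_option autoImplicit false

noncomputable section

open MeasureTheory ProbabilityTheory Finset
open scoped ENNReal BigOperators Matrix.Norms.L2Operator

namespace YMDAG.N14.AtSpineReading13CoPH.V.ClassLawRoads.K3V5

open Literature.MathematicalPhysics.QuantumFieldTheory.Balaban1983to89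
open Literature.MathematicalPhysics.QuantumFieldTheory.Balaban1983to89.T4Continuum
open Literature.MathematicalPhysics.QuantumFieldTheory.Balaban1983to89.Node00
open T4ContinuumYM4Torus (ForSmallCouplings)
open Summit.QuantumFields.BalabanUV.T4Continuum.Spine
open Summit.QuantumFields.BalabanUV.T4Continuum.NE1p.DressedMGFForm (TiltedMeanMatching)
open Summit.QuantumFields.YangMills.Theorems.K3V5Defs (SpineReading RateReadingFn RunSel LetterReading CutReading rrOfRecord PHolderD4 KeyedRatesHolderD4 GuardedReadingN16
  KeyedRelWeight KeyedShellWeight KeyedCoreEdgeHolderD4 KeyedExtraction LiveSel PinnedAtLive spineGivenEndpointR13SepCoPH_of_stubTexts)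
open Summit.QuantumFields.YangMills.BalabanUVNodes.N20ZeroDialFacesAtRecord13CoPHV (keyedRelWeight_shape_crOfRecord₁₃V_cutZero keyedShellWeight_shape_crOfRecord₁₃VAt_cutReading_shellZero
  keyedExtraction_shape_crOfRecord₁₃VAt_cutReading_of_live)
open YMDAG.UVSplit hiding SU
open YMDAG.N14.AtSpineReading13CoPH
open YMDAG.N14.AtSpineReading13CoPH.V.ClassLawRoads.ZeroDial (core_crOfRecord₁₃VAt_zeroDial_of_classSandwich core_crOfRecord₁₃VAt_zeroDial_of_massSandwich_of_tv)
open YMDAG.N14.AtSpineReading13CoPH.V.ClassLawRoads.Binder (tiltedMeanMatching_crOfRecord₁₃VAt_cutZero_of_classSandwich)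

/-! ## §1 The free dials of stub 2, BY NAME (`K3V5Defs` predicates at dag-n20-d's V reading) -/

/-- **`PinnedAtLive` IS `rfl` AT THE READING OF RECORD**: for every per-tuple cut reading `jc` and shell split `sh`, the reading `fun F θ hP g₀ os ↦ crOfRecord₁₃VAt 0 (jc F θ hP g₀ os) sh F θ hP
g₀ os` is pinned at live (indeed everywhere; `crOfRecord₁₃V = crOfRecord₁₃VAt 0` is dag-n20-d's `crOfRecord₁₃V_eq`, `rfl`). [bookkeeping] -/
theorem pinnedAtLive_crOfRecord₁₃VAt_cutReading (jc : CutReading) (sh : ShellSplit₁₃CoPH 2 0) :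
    PinnedAtLive jc sh fun F θ hP g₀ os => crOfRecord₁₃VAt 0 (jc F θ hP g₀ os) sh F θ hP g₀ os :=
  fun _ _ _ _ _ _ => rfl

/-- **THE N20 CONJUNCT IS FREE AT THE ZERO CUT, BY NAME**: `K3V5Defs.KeyedRelWeight (crOfRecord₁₃V (fun _ ↦ 0) sh)` for every shell split `sh` (dag-n20-w1's spelled shape
`keyedRelWeight_shape_crOfRecord₁₃V_cutZero`, i.e. dag-n20-w2's empty bad class + the canonical least weight, at every tuple; the guards unused). [bookkeeping] -/
theorem keyedRelWeight_crOfRecord₁₃V_cutZero (sh : ShellSplit₁₃CoPH 2 0) : KeyedRelWeight (crOfRecord₁₃V (fun _ => 0) sh) :=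
  keyedRelWeight_shape_crOfRecord₁₃V_cutZero sh

/-- **THE N21 CONJUNCT IS FREE AT THE ZERO SHELL SPLIT, BY NAME**: `K3V5Defs.KeyedShellWeight` of the V reading at ANY per-tuple cut reading `jc` with the vanishing shell split
(dag-n20-w1's `keyedShellWeight_shape_crOfRecord₁₃VAt_cutReading_shellZero`, i.e. dag-n20-w2's `…N21KeyedShellWeightShellZero` at every tuple). [bookkeeping] -/
theorem keyedShellWeight_crOfRecord₁₃VAt_cutReading_shellZero (jc : CutReading) :
    KeyedShellWeight fun F θ hP g₀ os => crOfRecord₁₃VAt 0 (jc F θ hP g₀ os) (fun _ _ _ _ _ => (fun _ _ _ => 0, fun _ _ _ => 0)) F θ hP g₀ os :=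
  keyedShellWeight_shape_crOfRecord₁₃VAt_cutReading_shellZero jc

/-- **THE N27x CONJUNCT FROM THE KEYED LIVE-SELECTOR LINE, BY NAME**: IF at every guarded admissible Stage-13 tuple with core provisos the residual selector IS the live selector of record
(`K3V5Defs.LiveSel F θ` — the (w18) proviso content, here a BINDER) and law (H-ζ) `ZetaMeasurable` holds, THEN `K3V5Defs.KeyedExtraction` of the V reading at any cut reading `jc` and
shell split `sh` (dag-n20-w1's `keyedExtraction_shape_crOfRecord₁₃VAt_cutReading_of_live`; (H-U) is node00-def-K0c's absolute `localBgMeasurable`; END ∕ (B) not read). [bookkeeping] -/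
theorem keyedExtraction_crOfRecord₁₃VAt_cutReading_of_liveLine (jc : CutReading) (sh : ShellSplit₁₃CoPH 2 0)
    (hlive : ∀ (F : T4Family) (θ : Stage13HParams F 2), θ.Provisos₁₃CoPH F 2 → (θ.ZhUnity F 2 ∧ θ.SlotsNondegenerate₁₃ F 2) → θ.Admissible F 2 →
      LiveSel F θ ∧ ZetaMeasurable F 2 θ.ζ) :
    KeyedExtraction fun F θ hP g₀ os => crOfRecord₁₃VAt 0 (jc F θ hP g₀ os) sh F θ hP g₀ os :=
  keyedExtraction_shape_crOfRecord₁₃VAt_cutReading_of_live jc sh fun F θ hP hG hθ =>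
    ⟨(hlive F θ hP hG hθ).1, localBgMeasurable F 2 θ.ν, (hlive F θ hP hG hθ).2⟩

/-! ## §2 ★★ The N19′ conjunct BY NAME from ONE keyed class-law sentence of node U3 given the rates -/

section CoreEdge

variable (β : ℝ) (rr : RateReadingFn) (K₀ : ℕ)
  (hlive : ∀ (F : T4Family) (θ : Stage13HParams F 2), θ.Provisos₁₃CoPH F 2 → (θ.ZhUnity F 2 ∧ θ.SlotsNondegenerate₁₃ F 2) → θ.Admissible F 2 →
    LiveSel F θ ∧ ZetaMeasurable F 2 θ.ζ)
include hlive

/-- **★★ `KeyedCoreEdgeHolderD4` AT THE ZERO-DIAL V READING ⇐ NODE U3's KEYED CLASS-MEASURE SENTENCE GIVEN THE RATES.**  For EVERY exponent `β`, EVERY rate reading `rr` and EVERY prefix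
`K₀`: IF (keyed live line + (H-ζ)) and IF at every guarded admissible tuple, under the crux's own prefix `(B) → END → ForSmallCouplings D`, for every `os`, GIVEN the R-β rates `PHolderD4 β D
(rr F θ hP g₀ os)`, node U3's ONE-constant sandwich holds for the FULL class laws of record pushed to the unit lattice — SOME summable `r`, and for every `K` ONE `c` with `e^{c − r K}•(classMeasA₁₃
K x).map A_{K₀+K} ≤ (classMeasB₁₃ K x).map A_{K₀+K+1} ≤ e^{c + r K}•(classMeasA₁₃ K x).map A_{K₀+K}` AS MEASURES for EVERY key `x ∈ classSet₁₃ K` (no class excused, no shell subtracted, no source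
`t`) — THEN `K3V5Defs.KeyedCoreEdgeHolderD4 β (crOfRecord₁₃VAt K₀ (fun _ ↦ 0) (zero split)) rr` (`ForSmallCouplings.mono` + FILE 2 `core_crOfRecord₁₃VAt_zeroDial_of_classSandwich`, the
reading's own canonical `δ`).  NE7-S_cl GIVEN THE RATES is node N19′'s located content in class-law currency; NOT PRINTED for d = 4; produced by nobody. [bookkeeping] -/
theorem keyedCoreEdgeHolderD4_crOfRecord₁₃VAt_zeroDial_of_keyedClassSandwich
    (hS : ∀ (F : T4Family) (θ : Stage13HParams F 2) (hP : θ.Provisos₁₃CoPH F 2), (θ.ZhUnity F 2 ∧ θ.SlotsNondegenerate₁₃ F 2) → θ.Admissible F 2 →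
      B16.EndStatementBPrinted (datumOfRecord₁₃CoPH F 2 θ hP).C → DagBinding.EndpointExistence (datumOfRecord₁₃CoPH F 2 θ hP).C.toB12 →
        ForSmallCouplings (datumOfRecord₁₃CoPH F 2 θ hP) fun g₀ => ∀ os : List (ULoop F), PHolderD4 β (datumOfRecord₁₃CoPH F 2 θ hP) (rr F θ hP g₀ os) →
          ∃ r : ℕ → ℝ, Summable r ∧ ∀ K : ℕ, ∃ c : ℝ, ∀ x ∈ classSet₁₃ θ K₀ g₀ K,
            ENNReal.ofReal (Real.exp (c - r K)) • (classMeasA₁₃ θ K₀ g₀ K x).map ((T4RunLadder.unitFactorisation (datumOfRecord₁₃CoPH F 2 θ hP) (isPrintedAveraged_datumOfRecord₁₃CoPH F 2 θ hP).avgMeasurable g₀).A (K₀ + K)) ≤ (classMeasB₁₃ θ K₀ g₀ K x).map ((T4RunLadder.unitFactorisation (datumOfRecord₁₃CoPH F 2 θ hP) (isPrintedAveraged_datumOfRecord₁₃CoPH F 2 θ hP).avgMeasurable g₀).A (K₀ + K + 1)) ∧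
            (classMeasB₁₃ θ K₀ g₀ K x).map ((T4RunLadder.unitFactorisation (datumOfRecord₁₃CoPH F 2 θ hP) (isPrintedAveraged_datumOfRecord₁₃CoPH F 2 θ hP).avgMeasurable g₀).A (K₀ + K + 1)) ≤ ENNReal.ofReal (Real.exp (c + r K)) • (classMeasA₁₃ θ K₀ g₀ K x).map ((T4RunLadder.unitFactorisation (datumOfRecord₁₃CoPH F 2 θ hP) (isPrintedAveraged_datumOfRecord₁₃CoPH F 2 θ hP).avgMeasurable g₀).A (K₀ + K))) :
    KeyedCoreEdgeHolderD4 β (crOfRecord₁₃VAt K₀ (fun _ => 0) (fun _ _ _ _ _ => (fun _ _ _ => 0, fun _ _ _ => 0))) rr := by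
  intro F θ hP hG hθ hB hE
  obtain ⟨hsel, hζm⟩ := hlive F θ hP hG hθ
  refine (hS F θ hP hG hθ hB hE).mono fun g₀ h => ?_
  intro os hrates
  obtain ⟨r, hrs, hc⟩ := h os hrates
  exact ⟨_, core_crOfRecord₁₃VAt_zeroDial_of_classSandwich θ hP K₀ _ hsel hζm g₀ os hc hrs⟩

/-- **★★ THE SAME FROM NODE U3's KEYED MASS ∧ TV PAIR GIVEN THE RATES** (dag-n19-c currency: MASS_cl(`r₁`) of the FULL class measures of record THEMSELVES — one constant per `K`, every
key — ∧ TV_cl(`ρ`) of their NORMALISED push-forwards on every measurable set of the unit lattice, `Σ r₁, Σ ρ < ∞`; FILE 2 `core_crOfRecord₁₃VAt_zeroDial_of_massSandwich_of_tv`; no (I)-binder,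
no mean-value step).  NOT PRINTED for d = 4; produced by nobody. [bookkeeping] -/
theorem keyedCoreEdgeHolderD4_crOfRecord₁₃VAt_zeroDial_of_keyedMassTV
    (hMT : ∀ (F : T4Family) (θ : Stage13HParams F 2) (hP : θ.Provisos₁₃CoPH F 2), (θ.ZhUnity F 2 ∧ θ.SlotsNondegenerate₁₃ F 2) → θ.Admissible F 2 →
      B16.EndStatementBPrinted (datumOfRecord₁₃CoPH F 2 θ hP).C → DagBinding.EndpointExistence (datumOfRecord₁₃CoPH F 2 θ hP).C.toB12 →
        ForSmallCouplings (datumOfRecord₁₃CoPH F 2 θ hP) fun g₀ => ∀ os : List (ULoop F), PHolderD4 β (datumOfRecord₁₃CoPH F 2 θ hP) (rr F θ hP g₀ os) →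
          ∃ r₁ ρ : ℕ → ℝ, Summable r₁ ∧ Summable ρ ∧
            (∀ K : ℕ, ∃ c : ℝ, ∀ x ∈ classSet₁₃ θ K₀ g₀ K,
              ENNReal.ofReal (Real.exp (c - r₁ K)) * (classMeasA₁₃ θ K₀ g₀ K x) Set.univ ≤ (classMeasB₁₃ θ K₀ g₀ K x) Set.univ ∧ (classMeasB₁₃ θ K₀ g₀ K x) Set.univ ≤ ENNReal.ofReal (Real.exp (c + r₁ K)) * (classMeasA₁₃ θ K₀ g₀ K x) Set.univ) ∧
            (∀ (K : ℕ), ∀ x ∈ classSet₁₃ θ K₀ g₀ K, ∀ S : Set (GaugeField (F.P 0) 0 (Node00.SU 2)), MeasurableSet S →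
              |((classMeasB₁₃ θ K₀ g₀ K x).map ((T4RunLadder.unitFactorisation (datumOfRecord₁₃CoPH F 2 θ hP) (isPrintedAveraged_datumOfRecord₁₃CoPH F 2 θ hP).avgMeasurable g₀).A (K₀ + K + 1))).real S / ((classMeasB₁₃ θ K₀ g₀ K x).map ((T4RunLadder.unitFactorisation (datumOfRecord₁₃CoPH F 2 θ hP) (isPrintedAveraged_datumOfRecord₁₃CoPH F 2 θ hP).avgMeasurable g₀).A (K₀ + K + 1))).real Set.univ -
                ((classMeasA₁₃ θ K₀ g₀ K x).map ((T4RunLadder.unitFactorisation (datumOfRecord₁₃CoPH F 2 θ hP) (isPrintedAveraged_datumOfRecord₁₃CoPH F 2 θ hP).avgMeasurable g₀).A (K₀ + K))).real S / ((classMeasA₁₃ θ K₀ g₀ K x).map ((T4RunLadder.unitFactorisation (datumOfRecord₁₃CoPH F 2 θ hP) (isPrintedAveraged_datumOfRecord₁₃CoPH F 2 θ hP).avgMeasurable g₀).A (K₀ + K))).real Set.univ| ≤ ρ K)) :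
    KeyedCoreEdgeHolderD4 β (crOfRecord₁₃VAt K₀ (fun _ => 0) (fun _ _ _ _ _ => (fun _ _ _ => 0, fun _ _ _ => 0))) rr := by
  intro F θ hP hG hθ hB hE
  obtain ⟨hsel, hζm⟩ := hlive F θ hP hG hθ
  refine (hMT F θ hP hG hθ hB hE).mono fun g₀ h => ?_
  intro os hrates
  obtain ⟨r₁, ρ, hr₁, hρ, hM, hTV⟩ := h os hrates
  exact ⟨_, core_crOfRecord₁₃VAt_zeroDial_of_massSandwich_of_tv θ hP K₀ _ hsel hζm g₀ os hM hTV hr₁ hρ⟩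

end CoreEdge

/-! ## §3 ★★★ STUB 2's REGISTERED TEXT (v5 `stub_expansion13H`, `K3V5Defs` names) from the two keyed hypotheses -/

section StubText

variable
  (hlive : ∀ (F : T4Family) (θ : Stage13HParams F 2), θ.Provisos₁₃CoPH F 2 → (θ.ZhUnity F 2 ∧ θ.SlotsNondegenerate₁₃ F 2) → θ.Admissible F 2 →
    LiveSel F θ ∧ ZetaMeasurable F 2 θ.ζ)
include hlive

/-- **★★★ K3⁷ v5 STUB 2's TEXT, VERBATIM, FROM THE KEYED LIVE LINE AND NODE U3's KEYED CLASS-MEASURE SENTENCE.**  IF (keyed live-selector line + (H-ζ)) and IF stub 2's own two hypotheses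
— the N16-pinned guarded reading `GuardedReadingN16 𝔯 ksel ℓ ℓ₃ g B` and the prefix-keyed R-β rates `KeyedRatesHolderD4 β (rrOfRecord 𝔯 ksel)` — yield node U3's keyed one-constant
class-measure sentence §2 at `(β, rrOfRecord 𝔯 ksel)` and `K₀ = 0` (GIVEN the rates at the tuple), THEN for every exponent `β ∈ ]2/3, 1[` and every such reading the registered
conclusion holds: SOME cut reading, shell split and spine reading — the witness is the ZERO DIAL `(jc, sh, cr) := (0, 0, crOfRecord₁₃V 0 0)` — pinned at live, with `KeyedRelWeight`
(§1, free), `KeyedShellWeight` (§1, free), `KeyedExtraction` (§1, the live line) and `KeyedCoreEdgeHolderD4` (§2).  NOT a proof of `stub_expansion13H`: both hypotheses are DISPLAYED,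
inhabited for no tuple (K0⁷ OPEN), node U3's sentence produced by nobody. [bookkeeping] -/
theorem stubExpansion13HText_of_liveLine_of_keyedClassSandwich
    (hU3 : ∀ β : ℝ, 2 / 3 < β → β < 1 →
      ∀ (𝔯 : RateReading₁₃CoPH 2) (ksel : RunSel) (ℓ : LetterReading) (ℓ₃ : T4Family → Node00.NE3Letters₁₁) (g B : T4Family → ℝ),
        GuardedReadingN16 𝔯 ksel ℓ ℓ₃ g B → KeyedRatesHolderD4 β (rrOfRecord 𝔯 ksel) →
        ∀ (F : T4Family) (θ : Stage13HParams F 2) (hP : θ.Provisos₁₃CoPH F 2), (θ.ZhUnity F 2 ∧ θ.SlotsNondegenerate₁₃ F 2) → θ.Admissible F 2 →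
          B16.EndStatementBPrinted (datumOfRecord₁₃CoPH F 2 θ hP).C → DagBinding.EndpointExistence (datumOfRecord₁₃CoPH F 2 θ hP).C.toB12 →
            ForSmallCouplings (datumOfRecord₁₃CoPH F 2 θ hP) fun g₀ => ∀ os : List (ULoop F),
              PHolderD4 β (datumOfRecord₁₃CoPH F 2 θ hP) (rrOfRecord 𝔯 ksel F θ hP g₀ os) →
                ∃ r : ℕ → ℝ, Summable r ∧ ∀ K : ℕ, ∃ c : ℝ, ∀ x ∈ classSet₁₃ θ 0 g₀ K,
                  ENNReal.ofReal (Real.exp (c - r K)) • (classMeasA₁₃ θ 0 g₀ K x).map ((T4RunLadder.unitFactorisation (datumOfRecord₁₃CoPH F 2 θ hP) (isPrintedAveraged_datumOfRecord₁₃CoPH F 2 θ hP).avgMeasurable g₀).A (0 + K)) ≤ (classMeasB₁₃ θ 0 g₀ K x).map ((T4RunLadder.unitFactorisation (datumOfRecord₁₃CoPH F 2 θ hP) (isPrintedAveraged_datumOfRecord₁₃CoPH F 2 θ hP).avgMeasurable g₀).A (0 + K + 1)) ∧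
                  (classMeasB₁₃ θ 0 g₀ K x).map ((T4RunLadder.unitFactorisation (datumOfRecord₁₃CoPH F 2 θ hP) (isPrintedAveraged_datumOfRecord₁₃CoPH F 2 θ hP).avgMeasurable g₀).A (0 + K + 1)) ≤ ENNReal.ofReal (Real.exp (c + r K)) • (classMeasA₁₃ θ 0 g₀ K x).map ((T4RunLadder.unitFactorisation (datumOfRecord₁₃CoPH F 2 θ hP) (isPrintedAveraged_datumOfRecord₁₃CoPH F 2 θ hP).avgMeasurable g₀).A (0 + K))) :
    ∀ β : ℝ, 2 / 3 < β → β < 1 →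
      ∀ (𝔯 : RateReading₁₃CoPH 2) (ksel : RunSel) (ℓ : LetterReading) (ℓ₃ : T4Family → Node00.NE3Letters₁₁) (g B : T4Family → ℝ),
        GuardedReadingN16 𝔯 ksel ℓ ℓ₃ g B → KeyedRatesHolderD4 β (rrOfRecord 𝔯 ksel) →
        ∃ (jc : CutReading) (sh : ShellSplit₁₃CoPH 2 0) (cr : SpineReading), PinnedAtLive jc sh cr ∧
          KeyedRelWeight cr ∧ KeyedShellWeight cr ∧ KeyedExtraction cr ∧ KeyedCoreEdgeHolderD4 β cr (rrOfRecord 𝔯 ksel) := by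
  intro β hβ hβ' 𝔯 ksel ℓ ℓ₃ g B hG hr
  exact ⟨fun _ _ _ _ _ _ => 0, fun _ _ _ _ _ => (fun _ _ _ => 0, fun _ _ _ => 0), crOfRecord₁₃V (fun _ => 0) fun _ _ _ _ _ => (fun _ _ _ => 0, fun _ _ _ => 0),
    fun _ _ _ _ _ _ => rfl, keyedRelWeight_crOfRecord₁₃V_cutZero _, keyedShellWeight_crOfRecord₁₃VAt_cutReading_shellZero _,
    keyedExtraction_crOfRecord₁₃VAt_cutReading_of_liveLine _ _ hlive,
    keyedCoreEdgeHolderD4_crOfRecord₁₃VAt_zeroDial_of_keyedClassSandwich β (rrOfRecord 𝔯 ksel) 0 hlive (hU3 β hβ hβ' 𝔯 ksel ℓ ℓ₃ g B hG hr)⟩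

/-- **★★ … AND FROM NODE U3's KEYED MASS ∧ TV PAIR GIVEN THE RATES** (§2 twin, dag-n19-c currency). [bookkeeping] -/
theorem stubExpansion13HText_of_liveLine_of_keyedMassTV
    (hU3 : ∀ β : ℝ, 2 / 3 < β → β < 1 →
      ∀ (𝔯 : RateReading₁₃CoPH 2) (ksel : RunSel) (ℓ : LetterReading) (ℓ₃ : T4Family → Node00.NE3Letters₁₁) (g B : T4Family → ℝ),
        GuardedReadingN16 𝔯 ksel ℓ ℓ₃ g B → KeyedRatesHolderD4 β (rrOfRecord 𝔯 ksel) →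
        ∀ (F : T4Family) (θ : Stage13HParams F 2) (hP : θ.Provisos₁₃CoPH F 2), (θ.ZhUnity F 2 ∧ θ.SlotsNondegenerate₁₃ F 2) → θ.Admissible F 2 →
          B16.EndStatementBPrinted (datumOfRecord₁₃CoPH F 2 θ hP).C → DagBinding.EndpointExistence (datumOfRecord₁₃CoPH F 2 θ hP).C.toB12 →
            ForSmallCouplings (datumOfRecord₁₃CoPH F 2 θ hP) fun g₀ => ∀ os : List (ULoop F),
              PHolderD4 β (datumOfRecord₁₃CoPH F 2 θ hP) (rrOfRecord 𝔯 ksel F θ hP g₀ os) →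
                ∃ r₁ ρ : ℕ → ℝ, Summable r₁ ∧ Summable ρ ∧
                  (∀ K : ℕ, ∃ c : ℝ, ∀ x ∈ classSet₁₃ θ 0 g₀ K,
                    ENNReal.ofReal (Real.exp (c - r₁ K)) * (classMeasA₁₃ θ 0 g₀ K x) Set.univ ≤ (classMeasB₁₃ θ 0 g₀ K x) Set.univ ∧ (classMeasB₁₃ θ 0 g₀ K x) Set.univ ≤ ENNReal.ofReal (Real.exp (c + r₁ K)) * (classMeasA₁₃ θ 0 g₀ K x) Set.univ) ∧
                  (∀ (K : ℕ), ∀ x ∈ classSet₁₃ θ 0 g₀ K, ∀ S : Set (GaugeField (F.P 0) 0 (Node00.SU 2)), MeasurableSet S →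
                    |((classMeasB₁₃ θ 0 g₀ K x).map ((T4RunLadder.unitFactorisation (datumOfRecord₁₃CoPH F 2 θ hP) (isPrintedAveraged_datumOfRecord₁₃CoPH F 2 θ hP).avgMeasurable g₀).A (0 + K + 1))).real S / ((classMeasB₁₃ θ 0 g₀ K x).map ((T4RunLadder.unitFactorisation (datumOfRecord₁₃CoPH F 2 θ hP) (isPrintedAveraged_datumOfRecord₁₃CoPH F 2 θ hP).avgMeasurable g₀).A (0 + K + 1))).real Set.univ -
                      ((classMeasA₁₃ θ 0 g₀ K x).map ((T4RunLadder.unitFactorisation (datumOfRecord₁₃CoPH F 2 θ hP) (isPrintedAveraged_datumOfRecord₁₃CoPH F 2 θ hP).avgMeasurable g₀).A (0 + K))).real S / ((classMeasA₁₃ θ 0 g₀ K x).map ((T4RunLadder.unitFactorisation (datumOfRecord₁₃CoPH F 2 θ hP) (isPrintedAveraged_datumOfRecord₁₃CoPH F 2 θ hP).avgMeasurable g₀).A (0 + K))).real Set.univ| ≤ ρ K)) :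
    ∀ β : ℝ, 2 / 3 < β → β < 1 →
      ∀ (𝔯 : RateReading₁₃CoPH 2) (ksel : RunSel) (ℓ : LetterReading) (ℓ₃ : T4Family → Node00.NE3Letters₁₁) (g B : T4Family → ℝ),
        GuardedReadingN16 𝔯 ksel ℓ ℓ₃ g B → KeyedRatesHolderD4 β (rrOfRecord 𝔯 ksel) →
        ∃ (jc : CutReading) (sh : ShellSplit₁₃CoPH 2 0) (cr : SpineReading), PinnedAtLive jc sh cr ∧
          KeyedRelWeight cr ∧ KeyedShellWeight cr ∧ KeyedExtraction cr ∧ KeyedCoreEdgeHolderD4 β cr (rrOfRecord 𝔯 ksel) := by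
  intro β hβ hβ' 𝔯 ksel ℓ ℓ₃ g B hG hr
  exact ⟨fun _ _ _ _ _ _ => 0, fun _ _ _ _ _ => (fun _ _ _ => 0, fun _ _ _ => 0), crOfRecord₁₃V (fun _ => 0) fun _ _ _ _ _ => (fun _ _ _ => 0, fun _ _ _ => 0),
    fun _ _ _ _ _ _ => rfl, keyedRelWeight_crOfRecord₁₃V_cutZero _, keyedShellWeight_crOfRecord₁₃VAt_cutReading_shellZero _,
    keyedExtraction_crOfRecord₁₃VAt_cutReading_of_liveLine _ _ hlive,
    keyedCoreEdgeHolderD4_crOfRecord₁₃VAt_zeroDial_of_keyedMassTV β (rrOfRecord 𝔯 ksel) 0 hlive (hU3 β hβ hβ' 𝔯 ksel ℓ ℓ₃ g B hG hr)⟩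

end StubText

/-! ## §4 ★ Node N14's (I)-binder rides DOWNSTREAM of the same sentence (keyed, under the crux's prefix) -/

section Binder

variable {X : Type*} [MeasurableSpace X]

/-- A one-constant sandwich of two measures with rate `r` is one with rate `|r|` (`r ≤ |r|`, monotonicity of `e^{·}` and of `•` in the scalar). [folklore] -/
theorem sandwich_abs_rate {μ ν : Measure X} {c r : ℝ}
    (h : ENNReal.ofReal (Real.exp (c - r)) • μ ≤ ν ∧ ν ≤ ENNReal.ofReal (Real.exp (c + r)) • μ) :
    ENNReal.ofReal (Real.exp (c - |r|)) • μ ≤ ν ∧ ν ≤ ENNReal.ofReal (Real.exp (c + |r|)) • μ := by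
  have hmono : ∀ {a b : ℝ≥0∞}, a ≤ b → a • μ ≤ b • μ := fun hab =>
    Measure.le_iff'.2 fun s => by simp only [Measure.smul_apply, smul_eq_mul]; gcongr
  have h₁ : ENNReal.ofReal (Real.exp (c - |r|)) ≤ ENNReal.ofReal (Real.exp (c - r)) :=
    ENNReal.ofReal_le_ofReal (Real.exp_le_exp.2 (by linarith [le_abs_self r]))
  have h₂ : ENNReal.ofReal (Real.exp (c + r)) ≤ ENNReal.ofReal (Real.exp (c + |r|)) :=
    ENNReal.ofReal_le_ofReal (Real.exp_le_exp.2 (by linarith [le_abs_self r]))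
  exact ⟨(hmono h₁).trans h.1, h.2.trans (hmono h₂)⟩

variable (β : ℝ) (rr : RateReadingFn) (K₀ : ℕ) (sh : ShellSplit₁₃CoPH 2 K₀)
  (hlive : ∀ (F : T4Family) (θ : Stage13HParams F 2), θ.Provisos₁₃CoPH F 2 → (θ.ZhUnity F 2 ∧ θ.SlotsNondegenerate₁₃ F 2) → θ.Admissible F 2 →
    LiveSel F θ ∧ ZetaMeasurable F 2 θ.ζ)
include hlive

/-- **★ NODE N14's BINDER, KEYED, FROM THE SAME SENTENCE.**  Under §2's two hypotheses (only (H-ζ) of the live line is read), at every guarded admissible tuple, under the crux's prefix,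
for every `os`, GIVEN the rates: SOME summable `r` such that N14's (I)-binder `TiltedMeanMatching` holds at the zero-cut V reading `crOfRecord₁₃VAt K₀ (fun _ ↦ 0) sh` (ANY shell split) for
the record's observables and class measures with `η K = 4·e^{2 l₀}·(e^{2 |r K|} − 1)` (FILE 3 `tiltedMeanMatching_crOfRecord₁₃VAt_cutZero_of_classSandwich` at the rate `|r|`, §4
`sandwich_abs_rate`).  The located N14 word in K3V5 currency: node N14 = NE1′ adds NO letter to stub 2 — its binder is DOWNSTREAM of node U3's sentence. [bookkeeping] -/
theorem keyedTiltedMeanMatching_crOfRecord₁₃VAt_cutZero_of_keyedClassSandwich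
    (hS : ∀ (F : T4Family) (θ : Stage13HParams F 2) (hP : θ.Provisos₁₃CoPH F 2), (θ.ZhUnity F 2 ∧ θ.SlotsNondegenerate₁₃ F 2) → θ.Admissible F 2 →
      B16.EndStatementBPrinted (datumOfRecord₁₃CoPH F 2 θ hP).C → DagBinding.EndpointExistence (datumOfRecord₁₃CoPH F 2 θ hP).C.toB12 →
        ForSmallCouplings (datumOfRecord₁₃CoPH F 2 θ hP) fun g₀ => ∀ os : List (ULoop F), PHolderD4 β (datumOfRecord₁₃CoPH F 2 θ hP) (rr F θ hP g₀ os) →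
          ∃ r : ℕ → ℝ, Summable r ∧ ∀ K : ℕ, ∃ c : ℝ, ∀ x ∈ classSet₁₃ θ K₀ g₀ K,
            ENNReal.ofReal (Real.exp (c - r K)) • (classMeasA₁₃ θ K₀ g₀ K x).map ((T4RunLadder.unitFactorisation (datumOfRecord₁₃CoPH F 2 θ hP) (isPrintedAveraged_datumOfRecord₁₃CoPH F 2 θ hP).avgMeasurable g₀).A (K₀ + K)) ≤ (classMeasB₁₃ θ K₀ g₀ K x).map ((T4RunLadder.unitFactorisation (datumOfRecord₁₃CoPH F 2 θ hP) (isPrintedAveraged_datumOfRecord₁₃CoPH F 2 θ hP).avgMeasurable g₀).A (K₀ + K + 1)) ∧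
            (classMeasB₁₃ θ K₀ g₀ K x).map ((T4RunLadder.unitFactorisation (datumOfRecord₁₃CoPH F 2 θ hP) (isPrintedAveraged_datumOfRecord₁₃CoPH F 2 θ hP).avgMeasurable g₀).A (K₀ + K + 1)) ≤ ENNReal.ofReal (Real.exp (c + r K)) • (classMeasA₁₃ θ K₀ g₀ K x).map ((T4RunLadder.unitFactorisation (datumOfRecord₁₃CoPH F 2 θ hP) (isPrintedAveraged_datumOfRecord₁₃CoPH F 2 θ hP).avgMeasurable g₀).A (K₀ + K))) :
    ∀ (F : T4Family) (θ : Stage13HParams F 2) (hP : θ.Provisos₁₃CoPH F 2), (θ.ZhUnity F 2 ∧ θ.SlotsNondegenerate₁₃ F 2) → θ.Admissible F 2 →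
      B16.EndStatementBPrinted (datumOfRecord₁₃CoPH F 2 θ hP).C → DagBinding.EndpointExistence (datumOfRecord₁₃CoPH F 2 θ hP).C.toB12 →
        ForSmallCouplings (datumOfRecord₁₃CoPH F 2 θ hP) fun g₀ => ∀ os : List (ULoop F), PHolderD4 β (datumOfRecord₁₃CoPH F 2 θ hP) (rr F θ hP g₀ os) →
          letI := (crOfRecord₁₃VAt K₀ (fun _ => 0) sh F θ hP g₀ os).dec
          ∃ r : ℕ → ℝ, Summable r ∧
            TiltedMeanMatching (crOfRecord₁₃VAt K₀ (fun _ => 0) sh F θ hP g₀ os).l₀ (crOfRecord₁₃VAt K₀ (fun _ => 0) sh F θ hP g₀ os).T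
              (crOfRecord₁₃VAt K₀ (fun _ => 0) sh F θ hP g₀ os).Bad
              (fun K (U : GaugeField (F.P (K₀ + K)) 0 (Node00.SU 2)) => T4GenFunBounds.prodObs ((datumOfRecord₁₃CoPH F 2 θ hP).scheme g₀) (K₀ + K) os U) (classMeasA₁₃ θ K₀ g₀)
              (fun K (U : GaugeField (F.P (K₀ + K + 1)) 0 (Node00.SU 2)) => T4GenFunBounds.prodObs ((datumOfRecord₁₃CoPH F 2 θ hP).scheme g₀) (K₀ + K + 1) os U) (classMeasB₁₃ θ K₀ g₀)
              fun K => 4 * Real.exp (2 * (crOfRecord₁₃VAt K₀ (fun _ => 0) sh F θ hP g₀ os).l₀) * (Real.exp (2 * |r K|) - 1) := by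
  intro F θ hP hG hθ hB hE
  obtain ⟨-, hζm⟩ := hlive F θ hP hG hθ
  refine (hS F θ hP hG hθ hB hE).mono fun g₀ h => ?_
  intro os hrates
  obtain ⟨r, hrs, hc⟩ := h os hrates
  refine ⟨r, hrs, tiltedMeanMatching_crOfRecord₁₃VAt_cutZero_of_classSandwich θ hP K₀ sh hζm g₀ os (r := fun K => |r K|) (fun K => abs_nonneg _) fun K => ?_⟩
  obtain ⟨c, hcK⟩ := hc K
  exact ⟨c, fun x hx => sandwich_abs_rate (hcK x hx)⟩

end Binder

/-! ## §5 K3⁷ BY NAME modulo stub 1's text (one application of dag-n27-w1's by-name composition) -/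

/-- **K3⁷ `SpineGivenEndpointR13SepCoPH` BY NAME ⇐ stub 1's TEXT + the keyed live line + node U3's keyed class-measure sentence.**  The registered stub-1 text `h₁` (verbatim, a HYPOTHESIS —
`stub_rates13H` is OPEN), §3's two keyed hypotheses, ONE application of `K3V5Defs.spineGivenEndpointR13SepCoPH_of_stubTexts`.  What remains of K3⁷ on this road, read off the binders:
stub 1 (the pinned rates), the live-selector proviso + (H-ζ), and node U3's two-run class-law sentence.  NOT a proof of K3⁷ (three displayed hypotheses, inhabited ∕ produced by nobody);
K3⁷ OPEN, NOT claimed. [bookkeeping] -/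
theorem spineGivenEndpointR13SepCoPH_of_stubRatesText_of_liveLine_of_keyedClassSandwich
    (h₁ : ∃ β : ℝ, 2 / 3 < β ∧ β < 1 ∧ ∃ (𝔯 : RateReading₁₃CoPH 2) (ksel : RunSel) (ℓ : LetterReading) (ℓ₃ : T4Family → Node00.NE3Letters₁₁) (g B : T4Family → ℝ),
      GuardedReadingN16 𝔯 ksel ℓ ℓ₃ g B ∧ KeyedRatesHolderD4 β (rrOfRecord 𝔯 ksel))
    (hlive : ∀ (F : T4Family) (θ : Stage13HParams F 2), θ.Provisos₁₃CoPH F 2 → (θ.ZhUnity F 2 ∧ θ.SlotsNondegenerate₁₃ F 2) → θ.Admissible F 2 →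
      LiveSel F θ ∧ ZetaMeasurable F 2 θ.ζ)
    (hU3 : ∀ β : ℝ, 2 / 3 < β → β < 1 →
      ∀ (𝔯 : RateReading₁₃CoPH 2) (ksel : RunSel) (ℓ : LetterReading) (ℓ₃ : T4Family → Node00.NE3Letters₁₁) (g B : T4Family → ℝ),
        GuardedReadingN16 𝔯 ksel ℓ ℓ₃ g B → KeyedRatesHolderD4 β (rrOfRecord 𝔯 ksel) →
        ∀ (F : T4Family) (θ : Stage13HParams F 2) (hP : θ.Provisos₁₃CoPH F 2), (θ.ZhUnity F 2 ∧ θ.SlotsNondegenerate₁₃ F 2) → θ.Admissible F 2 →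
          B16.EndStatementBPrinted (datumOfRecord₁₃CoPH F 2 θ hP).C → DagBinding.EndpointExistence (datumOfRecord₁₃CoPH F 2 θ hP).C.toB12 →
            ForSmallCouplings (datumOfRecord₁₃CoPH F 2 θ hP) fun g₀ => ∀ os : List (ULoop F),
              PHolderD4 β (datumOfRecord₁₃CoPH F 2 θ hP) (rrOfRecord 𝔯 ksel F θ hP g₀ os) →
                ∃ r : ℕ → ℝ, Summable r ∧ ∀ K : ℕ, ∃ c : ℝ, ∀ x ∈ classSet₁₃ θ 0 g₀ K,
                  ENNReal.ofReal (Real.exp (c - r K)) • (classMeasA₁₃ θ 0 g₀ K x).map ((T4RunLadder.unitFactorisation (datumOfRecord₁₃CoPH F 2 θ hP) (isPrintedAveraged_datumOfRecord₁₃CoPH F 2 θ hP).avgMeasurable g₀).A (0 + K)) ≤ (classMeasB₁₃ θ 0 g₀ K x).map ((T4RunLadder.unitFactorisation (datumOfRecord₁₃CoPH F 2 θ hP) (isPrintedAveraged_datumOfRecord₁₃CoPH F 2 θ hP).avgMeasurable g₀).A (0 + K + 1)) ∧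
                  (classMeasB₁₃ θ 0 g₀ K x).map ((T4RunLadder.unitFactorisation (datumOfRecord₁₃CoPH F 2 θ hP) (isPrintedAveraged_datumOfRecord₁₃CoPH F 2 θ hP).avgMeasurable g₀).A (0 + K + 1)) ≤ ENNReal.ofReal (Real.exp (c + r K)) • (classMeasA₁₃ θ 0 g₀ K x).map ((T4RunLadder.unitFactorisation (datumOfRecord₁₃CoPH F 2 θ hP) (isPrintedAveraged_datumOfRecord₁₃CoPH F 2 θ hP).avgMeasurable g₀).A (0 + K))) :
    Summit.QuantumFields.YangMills.Theses.BalabanUVNodes.SpineGivenEndpointR13SepCoPH :=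
  spineGivenEndpointR13SepCoPH_of_stubTexts h₁ (stubExpansion13HText_of_liveLine_of_keyedClassSandwich hlive hU3)

end YMDAG.N14.AtSpineReading13CoPH.V.ClassLawRoads.K3V5

end
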